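import Literature.MathematicalPhysics.QuantumFieldTheory.Balaban1983to89.B1Eq324CumulantTaylor

/-!
# `Balaban3D.Proofs.Eq324Chi` — [B1] (3.24) p. 616 for the SMALL-FIELD BOX: the measurability / boundedness / volume
# inputs of LQB's `B1Eq324CumulantTaylor.eq324_chi` DISCHARGED when χ is the characteristic function of an open set under
# a probability measure charging open sets and V is bounded on that set — the shape of (22)/(51)/(55) in [B10]

Lane «pub-balaban3d», seat p5; LEAF-LEDGER row C3 note «[B1](3.24) by INSTANTIATING `eq324_of_truncated_bound` (its
measurability/boundedness inputs = p5's obligations about 𝔇)».  Kernel glue; no definition, no named fact.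

THE PRINTED TEXT.  [B10] p. 260 after (18) / p. 268 L34: «where χ = Π_{b∈Ω₁} χ({|A(b)| < g₀p²(g₀)})», «χ = Π_{b∈B(Λ_{k+1})}
χ({|A(b)| < g_kp²(g_k)})» — χ is the characteristic function of an OPEN box of the Gaussian variables A; (22) p. 261 /
(55) p. 269: the fluctuation integral `∫dμ_{C^{(k)}}(A) χ exp[…]` against the Gaussian probability measure dμ_{C^{(k)}}
(D-p5-2: p1's `pieces3` defines `logFl := log ∫ χ·exp 𝒱 dμ^{(k)}`).  [B1] p. 616 (3.24): «⟨χ exp(V)⟩ = exp[⟨V⟩ + (1/2!)⟨V²⟩ᵀ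
+ … + (1/n̄!)⟨V^{n̄}⟩ᵀ + O(εᵏ)|T₁|], κ > d.» (`B1Sect3Statements.Eq324`).

WHAT IS PROVED.
* `eq324_indicator` — μ a probability measure positive on open sets (`IsOpenPosMeasure`; a non-degenerate Gaussian is),
  `O` open and nonempty (the small-field box, 0 ∈ O), `V` μ-a.e.-measurable with `|V| ≤ B` on `O`: the three analytic
  leaves of (3.24) — (a) `|log μ(O)| ≤ C₁·s^κ·vol` (small-field volume), (b) the re-expansion of the printed cumulants
  about those of the box-restricted law (`B10Eq24Cumulant.chiMeasure μ (𝟙_O)`), (c) the (n̄+1)-st derivative of the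
  box-restricted cumulant generating function (the cumulant lemma proper, [B1] → Benfatto et al. [2] p. 152) — give
  `Eq324 (∫_{O} e^{V} dμ) cum n̄ (C₁ + C₂ + C₃) s κ vol`; every measure-theoretic side condition of `eq324_chi` is
  discharged here (χ = 𝟙_O measurable, 0 ≤ χ ≤ 1, ⟨χ⟩ = μ(O) > 0, the bound on {χ ≠ 0} = O).
* `eq324_indicator_of_measurableSet` — the same for a MEASURABLE box with `μ O ≠ 0` (no topology; the carrier's form,
  p1 `StepSeries.box`/`μ`).
* `integral_indicator_mul_exp` — `∫ 𝟙_O·e^{V} dμ = ∫_{O} e^{V} dμ` (the two spellings of ⟨χ e^V⟩).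
[cite: Balaban1982Higgs1, (3.24) p.616]
-/

open MeasureTheory
open scoped BigOperators Nat

namespace Summit.QuantumFields.Balaban3D.Proofs

open Literature.MathematicalPhysics.QuantumFieldTheory.Balaban1983to89
open Literature.MathematicalPhysics.QuantumFieldTheory.Balaban1983to89.B1Sect3Statements (Eq324)
open Literature.MathematicalPhysics.QuantumFieldTheory.Balaban1983to89.B10Eq24Cumulant (chiMeasure truncExp)

variable {Ω : Type*} [MeasurableSpace Ω]

/-- `⟨χ e^V⟩` with χ = 𝟙_O is the integral of `e^V` over `O`. [folklore] -/
theorem integral_indicator_mul_exp (μ : Measure Ω) {O : Set Ω} (hO : MeasurableSet O) (V : Ω → ℝ) :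
    ∫ ω, O.indicator (fun _ => (1 : ℝ)) ω * Real.exp (V ω) ∂μ = ∫ ω in O, Real.exp (V ω) ∂μ := by
  rw [← integral_indicator hO]
  refine integral_congr_ae (Filter.Eventually.of_forall fun ω => ?_)
  by_cases hω : ω ∈ O <;> simp [hω]

/-- **(3.24) for a measurable small-field box of positive measure** (the carrier's form, p1 `StepSeries`: no topology
on the fluctuation space is needed): `μ` a probability measure, `O` measurable with `μ O ≠ 0`, `V` μ-a.e.-measurable with
`|V| ≤ B` on `O`; the three analytic leaves (a) `|log μ(O)| ≤ C₁·s^κ·vol`, (b) re-expansion of `cum` about the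
box-restricted cumulants, (c) the cumulant-remainder bound, give `Eq324 (∫_{O} e^{V} dμ) cum n̄ (C₁ + C₂ + C₃) s κ vol`
— LQB `B1Eq324CumulantTaylor.eq324_chi` with χ := 𝟙_O, all its side conditions discharged.
[cite: Balaban1982Higgs1, (3.24) p.616] -/
theorem eq324_indicator_of_measurableSet (μ : Measure Ω) [IsProbabilityMeasure μ] {O : Set Ω} (hO : MeasurableSet O)
    (hOpos : μ O ≠ 0) {V : Ω → ℝ} (hV : AEMeasurable V μ) {B : ℝ} (hVB : ∀ ω ∈ O, |V ω| ≤ B) (nbar : ℕ)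
    (cum : ℕ → ℝ) {C₁ C₂ C₃ s κ vol : ℝ}
    (ha : |Real.log (μ.real O)| ≤ C₁ * s ^ κ * vol)
    (hb : |∑ n ∈ Finset.Icc 1 nbar,
        (cum n - truncExp V (chiMeasure μ (O.indicator fun _ => (1 : ℝ))) n) / (n ! : ℝ)| ≤ C₂ * s ^ κ * vol)
    (hc : ∀ t ∈ Set.Icc (0 : ℝ) 1,
      |iteratedDeriv (nbar + 1) (ProbabilityTheory.cgf V (chiMeasure μ (O.indicator fun _ => (1 : ℝ)))) t|
        ≤ C₃ * ((nbar + 1)! : ℝ) * s ^ κ * vol) :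
    Eq324 (∫ ω in O, Real.exp (V ω) ∂μ) cum nbar (C₁ + C₂ + C₃) s κ vol := by
  have hχm : Measurable (O.indicator fun _ => (1 : ℝ)) := measurable_const.indicator hO
  have hχ0 : ∀ ω, 0 ≤ O.indicator (fun _ => (1 : ℝ)) ω := fun ω => by
    by_cases hω : ω ∈ O <;> simp [hω]
  have hχ1 : ∀ ω, O.indicator (fun _ => (1 : ℝ)) ω ≤ 1 := fun ω => by
    by_cases hω : ω ∈ O <;> simp [hω]
  have hint : ∫ ω, O.indicator (fun _ => (1 : ℝ)) ω ∂μ = μ.real O := integral_indicator_one hO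
  have hpos : 0 < ∫ ω, O.indicator (fun _ => (1 : ℝ)) ω ∂μ := by
    rw [hint, measureReal_def]
    exact ENNReal.toReal_pos hOpos (measure_ne_top μ O)
  have hVB' : ∀ ω, O.indicator (fun _ => (1 : ℝ)) ω ≠ 0 → |V ω| ≤ B := fun ω hω => by
    by_cases h : ω ∈ O
    · exact hVB ω h
    · simp [h] at hω
  rw [← hint] at ha
  rw [← integral_indicator_mul_exp μ hO V]
  exact B1Eq324CumulantTaylor.eq324_chi hχm hχ0 hχ1 hpos hV hVB' nbar cum ha hb hc

variable [TopologicalSpace Ω] [OpensMeasurableSpace Ω]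


/-- **(3.24) for the small-field box**: `μ` a probability measure charging open sets, `O` open nonempty, `V`
μ-a.e.-measurable with `|V| ≤ B` on `O`; the three analytic leaves (a) small-field volume `|log μ(O)| ≤ C₁·s^κ·vol`,
(b) re-expansion of the printed cumulants `cum` about the box-restricted ones, (c) the cumulant-remainder bound on
`[0, 1]`, give `Eq324 (∫_{O} e^{V} dμ) cum n̄ (C₁ + C₂ + C₃) s κ vol` — LQB `B1Eq324CumulantTaylor.eq324_chi` with all its
measure-theoretic side conditions discharged for χ = 𝟙_O. [cite: Balaban1982Higgs1, (3.24) p.616] -/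
theorem eq324_indicator (μ : Measure Ω) [IsProbabilityMeasure μ] [μ.IsOpenPosMeasure] {O : Set Ω} (hO : IsOpen O)
    (hne : O.Nonempty) {V : Ω → ℝ} (hV : AEMeasurable V μ) {B : ℝ} (hVB : ∀ ω ∈ O, |V ω| ≤ B) (nbar : ℕ)
    (cum : ℕ → ℝ) {C₁ C₂ C₃ s κ vol : ℝ}
    (ha : |Real.log (μ.real O)| ≤ C₁ * s ^ κ * vol)
    (hb : |∑ n ∈ Finset.Icc 1 nbar,
        (cum n - truncExp V (chiMeasure μ (O.indicator fun _ => (1 : ℝ))) n) / (n ! : ℝ)| ≤ C₂ * s ^ κ * vol)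
    (hc : ∀ t ∈ Set.Icc (0 : ℝ) 1,
      |iteratedDeriv (nbar + 1) (ProbabilityTheory.cgf V (chiMeasure μ (O.indicator fun _ => (1 : ℝ)))) t|
        ≤ C₃ * ((nbar + 1)! : ℝ) * s ^ κ * vol) :
    Eq324 (∫ ω in O, Real.exp (V ω) ∂μ) cum nbar (C₁ + C₂ + C₃) s κ vol :=
  eq324_indicator_of_measurableSet μ hO.measurableSet (hO.measure_pos μ hne).ne' hV hVB nbar cum ha hb hc

end Summit.QuantumFields.Balaban3D.Proofs
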